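import Literature.NumberTheory.LFunctions.ChebyshevHalfLineBiasOrderMProofs
import Literature.NumberTheory.LFunctions.ChebyshevHalfLineBiasImprimitiveRiesz
import Literature.NumberTheory.LFunctions.ChebyshevHalfLineBiasLogDerivHalf
import HarnessLib

/-!
# GRH-EQUIVALENT criteria (Suzuki 2025, Thm 8, second half: (4.2) ⟺ GRH, the sign clause, (4.2') ⟺ GRH), PROVED — «nothing here bears on the truth of RH»
# Discharge of the named fact `Suzuki2025Chebyshev_thm8_limits`

LINE 1 — LABEL: RH-FREE literature (a kernel proof of GRH-EQUIVALENCES for Dirichlet `L`-functions; the «GRH ⟹ limit»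
halves are GRH-CONDITIONAL asymptotics, the «limit ⟹ GRH» halves are GRH-implying criteria). bears_on: LADDER-RH
COLUMN 1 SCREW (S-C, criterion rung). WHAT THIS IS NOT: not a route, not progress toward RH or GRH — an equivalence
fixes WHICH limit statements are the GRH for `L(s, χ)`; nothing here bears on the truth of RH.

M. Suzuki, *On variants of Chebyshev's conjecture*, Ramanujan J. **68** (2025), no. 4, art. 95 = arXiv:2411.07436
[`Suzuki2025Chebyshev`; PUBLISHED, refereed], §4.1 **Theorem 8, second half**, AS PRINTED: «the GRH for `L(s, χ)` holds
if and only if `Σ_{n ≤ x} Λ(n)χ(n)/√n (1 − log n/log x)` (4.2) converges as `x → ∞`. In this case, the limit is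
`−(L'/L)(1/2, χ)` … if we further assume that `χ` is primitive, the sum (4.1) has a constant sign for all sufficiently
large `x > 0` under (4.2) … Furthermore … the GRH for `L(s, χ)` holds if and only if
`(1/log x) Σ_{n ≤ x} Λ(n)χ(n)/√n (1 − log n/log x) → −m/2` (4.2')» — the named fact `Suzuki2025Chebyshev_thm8_limits`
of `ChebyshevHalfLineBiasCharacters.lean` (three clauses, RH literature-typing tranche 1), DISCHARGED here:
`Suzuki2025Chebyshev_thm8_limits_holds`, assembling tree theorems:

* clause (a), «GRH ⟹ (4.2)»: `HalfLineRieszImprimitive.tendsto_rieszMean_of_GRH'` (`ChebyshevHalfLineBiasImprimitiveRiesz.lean`,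
  every non-principal `χ`; the primitive case `HalfLineRiesz.tendsto_rieszMean_of_GRH`, (4.5) via the exact smoothed
  explicit formula, `ChebyshevHalfLineBiasCharExplicitFormula.lean`); «(4.2) ⟹ GRH»:
  `DirichletHalfLineRiesz.riemannHypothesis_of_tendsto_rieszMean` (`ChebyshevHalfLineBiasThm8RieszProofs.lean`, absolute
  convergence of the transform on `Re s > 0` and an order comparison);
* clause (b), the sign: `DirichletLogDerivHalf.Suzuki2025Chebyshev_thm8_clause_b` (`ChebyshevHalfLineBiasLogDerivHalf.lean`:
  (4.6) `Re(L'/L)(½, χ) = ½[log(π/q) − ψ(¼ + κ/2)] ≠ 0`, with the kernel numerics `215 < 8πe^{γ+π/2} < 216`,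
  `9 < 8πe^{γ−π/2} < 10`);
* clause (c), «GRH ⟹ (4.2')»: `SuzukiThm8Limits.tendsto_rieszMean_div_log_of_GRH'` below — the primitive case is
  `HalfLineRiesz.tendsto_rieszMean_div_log_of_GRH` (`ChebyshevHalfLineBiasOrderMProofs.lean`, the order-`m` exact formula
  (4.5')), the reduction to the inducing primitive character uses `HalfLineRieszImprimitive.halfLineSum_eq_sub`,
  `sum_not_coprime_eq`, `norm_inner_sub_le` (the prime powers `p^k`, `p ∣ q`, contribute `O(log x)`) and
  `zeroOrder_eq_primitiveCharacter` (`m_χ = m_{χ*}`: the Euler factors `1 − χ*(p)p^{-s}` do not vanish at `½`);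
  «(4.2') ⟹ GRH»: `DirichletHalfLineRiesz.riemannHypothesis_of_tendsto_rieszMean_div_log`.

Theorems only (D-0014/D-0026): no definitions, no named facts; net debt −1.

## References
* [Suzuki2025Chebyshev] M. Suzuki, Ramanujan J. 68 (2025) 95 = arXiv:2411.07436: §4.1 Thm 8 (second half), (4.1),
  (4.2), (4.2'), (4.5), (4.5'), (4.6).
* [DavenportMNT1980] H. Davenport, *Multiplicative Number Theory*, 2nd ed., ch. 5 (2)–(3) (`L(s, χ) = L(s, χ*)Π(1 − χ*(p)p^{-s})`).
-/

noncomputable section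

open Complex Filter Topology Set ArithmeticFunction

namespace Literature.NumberTheory.LFunctions

namespace SuzukiThm8Limits

open HalfLineRiesz HalfLineRieszImprimitive

variable {q : ℕ} [NeZero q]

/-! ## §1 The order at `½` is that of the inducing primitive character -/

/-- `m_χ = m_{χ*}`: the order of `L(s, χ)` at `s = ½` equals that of `L(s, χ*)` (`L(s, χ) = L(s, χ*)·Π_{p∣q}(1 − χ*(p)p^{-s})`,
the Euler factors being analytic and non-zero at `½`). [cite: DavenportMNT1980, ch. 5 (2)–(3)] -/
theorem zeroOrder_eq_primitiveCharacter (χ : DirichletCharacter ℂ q) (hχ : χ ≠ 1) :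
    haveI : NeZero χ.conductor := ⟨χ.conductor_ne_zero⟩
    DirichletDisc.zeroOrder χ (1 / 2) = DirichletDisc.zeroOrder χ.primitiveCharacter (1 / 2) := by
  haveI : NeZero χ.conductor := ⟨χ.conductor_ne_zero⟩
  set ψ := χ.primitiveCharacter with hψ
  have hψ1 : ψ ≠ 1 := by
    intro h
    apply hχ
    rw [← DirichletCharacter.changeLevel_primitiveCharacter χ, ← hψ, h, map_one]
  set E : ℂ → ℂ := fun s ↦ ∏ p ∈ q.primeFactors, (1 - ψ p * (p : ℂ) ^ (-s)) with hE
  have hfun : χ.LFunction = fun s ↦ ψ.LFunction s * E s := by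
    funext s
    have key := DirichletCharacter.LFunction_changeLevel χ.conductor_dvd_level ψ (s := s) (Or.inl hψ1)
    rw [hψ, DirichletCharacter.changeLevel_primitiveCharacter] at key
    rw [key]
  have hdfac : ∀ s : ℂ, ∀ p ∈ q.primeFactors, DifferentiableAt ℂ (fun s : ℂ ↦ 1 - ψ p * (p : ℂ) ^ (-s)) s := by
    intro s p hp
    have hp0 : (p : ℂ) ≠ 0 := by exact_mod_cast (Nat.prime_of_mem_primeFactors hp).ne_zero
    exact ((differentiableAt_id.neg.const_cpow (Or.inl hp0)).const_mul _).const_sub _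
  have hEd : Differentiable ℂ E := fun s ↦ by
    rw [hE]
    exact DifferentiableAt.fun_finsetProd (hdfac s)
  have hEan : AnalyticAt ℂ E (1 / 2) := hEd.analyticAt _
  have hE0 : E (1 / 2) ≠ 0 := by
    rw [hE]
    exact Finset.prod_ne_zero_iff.2 fun p hp ↦
      DirichletCharacter.one_sub_mul_prime_cpow_ne_zero ψ (Nat.prime_of_mem_primeFactors hp) (by norm_num)
  have hψan : AnalyticAt ℂ ψ.LFunction (1 / 2) :=
    (DirichletCharacter.differentiable_LFunction hψ1).analyticAt _
  have hord : analyticOrderAt χ.LFunction (1 / 2) = analyticOrderAt ψ.LFunction (1 / 2) := by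
    rw [hfun, show (fun s ↦ ψ.LFunction s * E s) = ψ.LFunction * E from rfl,
      analyticOrderAt_mul hψan hEan, hEan.analyticOrderAt_eq_zero.2 hE0, add_zero]
  rw [DirichletDisc.zeroOrder, DirichletDisc.zeroOrder, analyticOrderNatAt, analyticOrderNatAt, hord]

/-! ## §2 «GRH ⟹ (4.2')» for every non-principal `χ` -/

/-- **Suzuki 2025, Thm 8, (4.2') ⟸ GRH, PROVED for every non-principal character**: for `χ ≠ χ₀` mod `q` the GRH for
`L(s, χ)` gives `(1/log x) Σ_{n ≤ x} Λ(n)χ(n) n^{-1/2}(1 − log n/log x) → −m_χ/2` (the typed clause (c) form). The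
primitive case is the tree's `HalfLineRiesz.tendsto_rieszMean_div_log_of_GRH`; for `χ` induced by `χ*`,
`f_χ = f_{χ*} − Σ_{p∣q}(…)` with the correction `O(log x)` (the tree's `HalfLineRieszImprimitive.halfLineSum_eq_sub`,
`sum_not_coprime_eq`, `norm_inner_sub_le`), so `(f_χ − f_{χ*})/log²x → 0`, and `m_χ = m_{χ*}`.
[cite: Suzuki2025Chebyshev, §4.1 Thm 8 ((4.2') ⟸ GRH)] -/
theorem tendsto_rieszMean_div_log_of_GRH' (χ : DirichletCharacter ℂ q) (hχ : χ ≠ 1)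
    (hGRH : χ.RiemannHypothesis) :
    Tendsto (fun x : ℝ ↦ (1 / (Real.log x : ℂ)) * ∑ n ∈ Finset.Icc 1 ⌊x⌋₊,
        (Λ n : ℂ) * χ (n : ZMod q) / (Real.sqrt n : ℂ) * ((1 - Real.log n / Real.log x : ℝ) : ℂ))
      atTop (𝓝 (-((DirichletDisc.zeroOrder χ (1 / 2) : ℂ) / 2))) := by
  haveI : NeZero χ.conductor := ⟨χ.conductor_ne_zero⟩
  have hN1 : 1 < χ.conductor := by
    have h1 : χ.conductor ≠ 1 := fun h ↦ hχ (DirichletCharacter.eq_one_iff_conductor_eq_one.2 h)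
    have h0 : χ.conductor ≠ 0 := χ.conductor_ne_zero
    omega
  set ψ := χ.primitiveCharacter with hψdef
  have hprim : ψ.IsPrimitive := DirichletCharacter.primitiveCharacter_isPrimitive χ
  have hψGRH : ψ.RiemannHypothesis :=
    (DirichletCharacter.riemannHypothesis_iff_primitiveCharacter_holds χ).1 hGRH
  have hψlim := HalfLineRiesz.tendsto_rieszMean_div_log_of_GRH hprim hN1 hψGRH
  rw [zeroOrder_eq_primitiveCharacter χ hχ]
  -- the difference `(f_χ(x) − f_{χ*}(x))/log²x → 0`
  set C₁ : ℝ := ∑ p ∈ q.primeFactors, (8 * Real.log p + 12 * Real.log p ^ 2) with hC₁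
  set C₂ : ℝ := ∑ p ∈ q.primeFactors, ‖(Real.log p : ℂ) * eulerRatio ψ p / (1 - eulerRatio ψ p)‖ with hC₂
  have hdiff : Tendsto (fun x : ℝ ↦
      (1 / (Real.log x : ℂ)) * ∑ n ∈ Finset.Icc 1 ⌊x⌋₊,
          (Λ n : ℂ) * χ (n : ZMod q) / (Real.sqrt n : ℂ) * ((1 - Real.log n / Real.log x : ℝ) : ℂ) -
        (1 / (Real.log x : ℂ)) * ∑ n ∈ Finset.Icc 1 ⌊x⌋₊,
          (Λ n : ℂ) * ψ (n : ZMod χ.conductor) / (Real.sqrt n : ℂ) * ((1 - Real.log n / Real.log x : ℝ) : ℂ))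
      atTop (𝓝 0) := by
    have hlim : Tendsto (fun x : ℝ ↦ C₁ * ((Real.log x)⁻¹ * (Real.log x)⁻¹) + C₂ * (Real.log x)⁻¹) atTop (𝓝 0) := by
      have h0 := tendsto_inv_atTop_zero.comp Real.tendsto_log_atTop
      have h := ((h0.mul h0).const_mul C₁).add (h0.const_mul C₂)
      simpa using h
    refine squeeze_zero_norm' ?_ hlim
    filter_upwards [eventually_gt_atTop (1 : ℝ)] with x hx
    have hx0 : 0 < x := by linarith
    have hlx : 0 < Real.log x := Real.log_pos hx
    have hlxC : (Real.log x : ℂ) ≠ 0 := by exact_mod_cast hlx.ne'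
    rw [rieszMean_eq_halfLineSum_div χ hx, rieszMean_eq_halfLineSum_div ψ hx, halfLineSum_eq_sub χ x,
      sum_not_coprime_eq ψ hx0]
    set corr := ∑ p ∈ q.primeFactors, ∑ k ∈ Finset.Icc 1 (Nat.log p ⌊x⌋₊),
      (Real.log p : ℂ) * eulerRatio ψ p ^ k * ((Real.log x - k * Real.log p : ℝ) : ℂ) with hcorr
    have heq : 1 / (Real.log x : ℂ) * ((halfLineSum ψ x - corr) / (Real.log x : ℂ)) -
        1 / (Real.log x : ℂ) * (halfLineSum ψ x / (Real.log x : ℂ)) =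
        -corr / ((Real.log x : ℂ) * (Real.log x : ℂ)) := by
      field_simp
      ring
    rw [heq, norm_div, norm_neg, norm_mul, Complex.norm_real, Real.norm_of_nonneg hlx.le,
      div_le_iff₀ (by positivity)]
    -- `‖corr‖ ≤ C₁ + C₂ log x`
    have hcorr_le : ‖corr‖ ≤ C₁ + C₂ * Real.log x := by
      rw [hcorr, hC₁, hC₂, Finset.sum_mul, ← Finset.sum_add_distrib]
      refine (norm_sum_le _ _).trans (Finset.sum_le_sum fun p hp ↦ ?_)
      have hpp := Nat.prime_of_mem_primeFactors hp
      have h1 := norm_inner_sub_le ψ hpp hx.le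
      set I := ∑ k ∈ Finset.Icc 1 (Nat.log p ⌊x⌋₊),
        (Real.log p : ℂ) * eulerRatio ψ p ^ k * ((Real.log x - k * Real.log p : ℝ) : ℂ)
      set c := (Real.log p : ℂ) * eulerRatio ψ p / (1 - eulerRatio ψ p)
      calc ‖I‖ = ‖(I - (Real.log x : ℂ) * c) + (Real.log x : ℂ) * c‖ := by rw [sub_add_cancel]
        _ ≤ ‖I - (Real.log x : ℂ) * c‖ + ‖(Real.log x : ℂ) * c‖ := norm_add_le _ _
        _ ≤ (8 * Real.log p + 12 * Real.log p ^ 2) + ‖c‖ * Real.log x := by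
            rw [norm_mul, Complex.norm_real, Real.norm_of_nonneg hlx.le]
            linarith
    calc ‖corr‖ ≤ C₁ + C₂ * Real.log x := hcorr_le
      _ = (C₁ * ((Real.log x)⁻¹ * (Real.log x)⁻¹) + C₂ * (Real.log x)⁻¹) * (Real.log x * Real.log x) := by
          field_simp
  have h := hdiff.add hψlim
  rw [zero_add] at h
  exact h.congr fun x ↦ by ring

end SuzukiThm8Limits

/-! ## §3 The discharge -/

/-- **Suzuki 2025, Theorem 8, second half, PROVED** — discharge of the named fact `Suzuki2025Chebyshev_thm8_limits`
(three clauses, AS TYPED in `ChebyshevHalfLineBiasCharacters.lean`): (a) for `χ ≠ χ₀` with `L(½, χ) ≠ 0`,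
«(4.2) converges to `−(L'/L)(½, χ)`» ⟺ GRH for `L(s, χ)`; (b) for primitive `χ` with `L(½, χ) ≠ 0`, (4.2) ⟹ the sign of
`Σ_{n ≤ x} Λ(n) Re χ(n)/√n · log(x/n)` is eventually constant; (c) for `χ ≠ χ₀`, «(4.2') tends to `−m_χ/2`» ⟺ GRH. The
pieces: (a) «⟸» `HalfLineRieszImprimitive.tendsto_rieszMean_of_GRH'` (rh-columns-lit), «⟹»
`DirichletHalfLineRiesz.riemannHypothesis_of_tendsto_rieszMean`; (b) `DirichletLogDerivHalf.Suzuki2025Chebyshev_thm8_clause_b`;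
(c) «⟸» `tendsto_rieszMean_div_log_of_GRH'`, «⟹» `DirichletHalfLineRiesz.riemannHypothesis_of_tendsto_rieszMean_div_log`.
An EQUIVALENCE with GRH-type statements: it fixes which limit statements ARE the GRH for `L(s, χ)`; nothing here bears on
the truth of RH or GRH. [cite: Suzuki2025Chebyshev, §4.1 Thm 8 (second half)] -/
theorem Suzuki2025Chebyshev_thm8_limits_holds : Suzuki2025Chebyshev_thm8_limits := by
  refine ⟨?_, DirichletLogDerivHalf.Suzuki2025Chebyshev_thm8_clause_b, ?_⟩
  · intro q _ χ hχ hhalf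
    exact ⟨fun h ↦ DirichletHalfLineRiesz.riemannHypothesis_of_tendsto_rieszMean hχ h,
      fun hGRH ↦ HalfLineRieszImprimitive.tendsto_rieszMean_of_GRH' χ hχ hhalf hGRH⟩
  · intro q _ χ hχ
    exact ⟨fun h ↦ DirichletHalfLineRiesz.riemannHypothesis_of_tendsto_rieszMean_div_log hχ h,
      fun hGRH ↦ SuzukiThm8Limits.tendsto_rieszMean_div_log_of_GRH' χ hχ hGRH⟩

end Literature.NumberTheory.LFunctions

end
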